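import Mathlib

/-!
# SoloBlind — the curve `234446a1`, four points, and a two-descent certificate kit

Ingredients for a kernel certificate that the elliptic curve
`E4 : y² + xy = x³ − x² − 79x + 289` (Cremona label `234446a1`; nothing depends on the label)
has four `ℤ`-independent rational points, WITHOUT reduction maps, heights or descent
homomorphisms (none of which Mathlib has):

* `linearIndependent_int_of_two_descent`: in an abelian group without `2`-torsion, elements whose
  non-trivial `𝔽₂`-combinations are never doubles are `ℤ`-linearly independent (infinite descent);
* `quartic_ne_zero_of_zmod` / `cubic_ne_zero_of_zmod`: an integral binary form with only the trivial
  zero modulo some `ℓ > 1` has no rational zero (reduce a primitive representative);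
* the curve `E4` and the points `P₀ = (0,−17)`, `P₁ = (3,7)`, `P₂ = (−4,−21)`, `P₃ = (4,3)`, and the
  eleven chord sums needed to name all fifteen non-empty subset sums `Q_S = Σ_{i∈S} Pᵢ`;
* `not_double`: if `Q = R + R` in `E4(ℚ)` then `x(R)` is a rational zero of the duplication quartic
  `φ₂(x) − x(Q) ψ₂²(x) = x⁴ + 158x² − 2312x + 7108 − x(Q)(4x³ − 3x² − 316x + 1156)`;
* `E4_two_torsion_free`: `E4(ℚ)[2] = 0`, since `ψ₂²` has no zero in `ℙ¹(𝔽₃)`.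

The certificate itself (fifteen `decide`s) and its consequences for rank-BSD are in
`SoloBlindRankFourWitness`.  STYLE: the file introduces no definitions and no notation — every
statement is about a Weierstrass curve `W` under the hypothesis `hW : W = ⟨1, -1, 0, -79, 289⟩`,
and the point `Pₛ` is written `Point.some _ _ (nsₛ hW)`; all group-law statements are made for an
arbitrary `DecidableEq ℚ` instance, so that they specialise to the classical instance hidden in
`WeierstrassCurve.mordellWeilRank`.
-/

set_option linter.dupNamespace false

namespace Summit.BirchSwinnertonDyer.BirchSwinnertonDyer.Theorems.SoloBlind

open WeierstrassCurve WeierstrassCurve.Affine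

/-! ## Two-descent independence lemma and root exclusion modulo a prime -/

/-- **Two-descent independence lemma.** In an abelian group `G` without `2`-torsion, a family
`P : Fin n → G` whose non-trivial `𝔽₂`-combinations are never doubles is `ℤ`-linearly independent
(infinite descent on `Σ |gᵢ|`: in a relation all coefficients must be even, then halve). -/
theorem linearIndependent_int_of_two_descent {G : Type*} [AddCommGroup G] {n : ℕ}
    (P : Fin n → G)
    (htor : ∀ R : G, R + R = 0 → R = 0)
    (hind : ∀ ε : Fin n → Bool, ε ≠ (fun _ => false) →
      ∀ R : G, (∑ i, if ε i then P i else 0) ≠ R + R) :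
    LinearIndependent ℤ P := by
  rw [Fintype.linearIndependent_iff]
  suffices h : ∀ N : ℕ, ∀ g : Fin n → ℤ, (∑ i, (g i).natAbs) = N →
      (∑ i, g i • P i) = 0 → ∀ i, g i = 0 from fun g hg => h _ g rfl hg
  intro N
  induction N using Nat.strong_induction_on with
  | _ N ih =>
    intro g hN hg
    by_cases hodd : ∃ i, g i % 2 = 1
    · exfalso
      have hne : (fun i => decide (g i % 2 = 1)) ≠ fun _ => false := by
        obtain ⟨i, hi⟩ := hodd
        intro h
        have := congrFun h i
        simp [hi] at this
      have hdec : ∀ i, g i = 2 * (g i / 2) + g i % 2 := fun i => by omega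
      have hbit : ∀ i, (g i % 2) • P i = if decide (g i % 2 = 1) then P i else 0 := by
        intro i
        rcases Int.emod_two_eq_zero_or_one (g i) with h0 | h1
        · simp [h0]
        · simp [h1]
      set R : G := ∑ i, (g i / 2) • P i with hR
      have hsplit : (∑ i, g i • P i)
          = R + R + ∑ i, (if decide (g i % 2 = 1) then P i else 0) := by
        rw [hR, ← Finset.sum_add_distrib, ← Finset.sum_add_distrib]
        refine Finset.sum_congr rfl fun i _ => ?_
        have step : g i • P i = (2 * (g i / 2) + g i % 2) • P i := by
          conv_lhs => rw [hdec i]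
        rw [step, add_smul, mul_smul, two_smul, hbit i]
      refine hind _ hne (-R) ?_
      have h0 : R + R + ∑ i, (if decide (g i % 2 = 1) then P i else 0) = 0 := hsplit ▸ hg
      calc (∑ i, if decide (g i % 2 = 1) then P i else 0)
          = (R + R + ∑ i, (if decide (g i % 2 = 1) then P i else 0)) - (R + R) := by abel
        _ = -R + -R := by rw [h0]; abel
    · push Not at hodd
      by_cases hg0 : ∀ i, g i = 0
      · exact hg0
      push Not at hg0
      obtain ⟨i₀, hi₀⟩ := hg0
      set g' : Fin n → ℤ := fun i => g i / 2 with hg'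
      have hdec : ∀ i, g i = 2 * g' i := by
        intro i
        have h0 : g i % 2 = 0 := by
          rcases Int.emod_two_eq_zero_or_one (g i) with h | h
          · exact h
          · exact absurd h (hodd i)
        simp only [g']
        omega
      set R : G := ∑ i, g' i • P i with hR
      have hsplit : (∑ i, g i • P i) = R + R := by
        rw [hR, ← Finset.sum_add_distrib]
        refine Finset.sum_congr rfl fun i _ => ?_
        rw [hdec i, mul_smul, two_smul]
      have hR0 : R = 0 := htor R (hsplit ▸ hg)
      have habs : ∀ i, (g i).natAbs = 2 * (g' i).natAbs := by
        intro i; rw [hdec i, Int.natAbs_mul]; rfl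
      have hlt : (∑ i, (g' i).natAbs) < N := by
        rw [← hN]
        have hle : ∀ i ∈ Finset.univ, (g' i).natAbs ≤ (g i).natAbs := by
          intro i _; rw [habs i]; omega
        have hi₀' : (g' i₀).natAbs < (g i₀).natAbs := by
          rw [habs i₀]
          have hne0 : g' i₀ ≠ 0 := by
            intro h; apply hi₀; rw [hdec i₀, h, mul_zero]
          have : 0 < (g' i₀).natAbs := Int.natAbs_pos.mpr hne0
          omega
        exact Finset.sum_lt_sum hle ⟨i₀, Finset.mem_univ _, hi₀'⟩
      have hg'0 := ih _ hlt g' rfl (by rw [← hR]; exact hR0)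
      intro i
      rw [hdec i, hg'0 i, mul_zero]

/-- A degree-four integer binary form with only the trivial zero modulo `ℓ > 1` has no rational
zero with second coordinate `1`. -/
theorem quartic_ne_zero_of_zmod (ℓ : ℕ) (hℓ : 1 < ℓ) (c₀ c₁ c₂ c₃ c₄ : ℤ)
    (h : ∀ a b : ZMod ℓ, (c₄ : ZMod ℓ) * a ^ 4 + c₃ * a ^ 3 * b + c₂ * a ^ 2 * b ^ 2
      + c₁ * a * b ^ 3 + c₀ * b ^ 4 = 0 → a = 0 ∧ b = 0)
    (x : ℚ) : (c₄ : ℚ) * x ^ 4 + c₃ * x ^ 3 + c₂ * x ^ 2 + c₁ * x + c₀ ≠ 0 := by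
  haveI : NeZero ℓ := ⟨by omega⟩
  intro hx
  have hmul : x * (x.den : ℚ) = x.num := Rat.mul_den_eq_num x
  have key : c₄ * x.num ^ 4 + c₃ * x.num ^ 3 * x.den + c₂ * x.num ^ 2 * (x.den : ℤ) ^ 2
      + c₁ * x.num * (x.den : ℤ) ^ 3 + c₀ * (x.den : ℤ) ^ 4 = 0 := by
    have e : ((c₄ : ℚ) * x ^ 4 + c₃ * x ^ 3 + c₂ * x ^ 2 + c₁ * x + c₀) * (x.den : ℚ) ^ 4
        = (c₄ : ℚ) * (x * x.den) ^ 4 + c₃ * (x * x.den) ^ 3 * x.den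
          + c₂ * (x * x.den) ^ 2 * (x.den : ℚ) ^ 2 + c₁ * (x * x.den) * (x.den : ℚ) ^ 3
          + c₀ * (x.den : ℚ) ^ 4 := by ring
    rw [hmul, hx, zero_mul] at e
    exact_mod_cast e.symm
  have hz := congrArg (Int.cast : ℤ → ZMod ℓ) key
  push_cast at hz
  obtain ⟨ha, hb⟩ := h _ _ hz
  have h1 : (ℓ : ℤ) ∣ x.num := (ZMod.intCast_zmod_eq_zero_iff_dvd _ _).mp ha
  have h2 : ℓ ∣ x.den := (ZMod.natCast_eq_zero_iff _ _).mp hb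
  have h1' : ℓ ∣ x.num.natAbs := Int.natCast_dvd.mp h1
  have := Nat.eq_one_of_dvd_coprimes x.reduced h1' h2
  omega

/-- Same for degree three. -/
theorem cubic_ne_zero_of_zmod (ℓ : ℕ) (hℓ : 1 < ℓ) (c₀ c₁ c₂ c₃ : ℤ)
    (h : ∀ a b : ZMod ℓ, (c₃ : ZMod ℓ) * a ^ 3 + c₂ * a ^ 2 * b + c₁ * a * b ^ 2
      + c₀ * b ^ 3 = 0 → a = 0 ∧ b = 0)
    (x : ℚ) : (c₃ : ℚ) * x ^ 3 + c₂ * x ^ 2 + c₁ * x + c₀ ≠ 0 := by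
  haveI : NeZero ℓ := ⟨by omega⟩
  intro hx
  have hmul : x * (x.den : ℚ) = x.num := Rat.mul_den_eq_num x
  have key : c₃ * x.num ^ 3 + c₂ * x.num ^ 2 * x.den + c₁ * x.num * (x.den : ℤ) ^ 2
      + c₀ * (x.den : ℤ) ^ 3 = 0 := by
    have e : ((c₃ : ℚ) * x ^ 3 + c₂ * x ^ 2 + c₁ * x + c₀) * (x.den : ℚ) ^ 3
        = (c₃ : ℚ) * (x * x.den) ^ 3 + c₂ * (x * x.den) ^ 2 * x.den
          + c₁ * (x * x.den) * (x.den : ℚ) ^ 2 + c₀ * (x.den : ℚ) ^ 3 := by ring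
    rw [hmul, hx, zero_mul] at e
    exact_mod_cast e.symm
  have hz := congrArg (Int.cast : ℤ → ZMod ℓ) key
  push_cast at hz
  obtain ⟨ha, hb⟩ := h _ _ hz
  have h1 : (ℓ : ℤ) ∣ x.num := (ZMod.intCast_zmod_eq_zero_iff_dvd _ _).mp ha
  have h2 : ℓ ∣ x.den := (ZMod.natCast_eq_zero_iff _ _).mp hb
  have h1' : ℓ ∣ x.num.natAbs := Int.natCast_dvd.mp h1
  have := Nat.eq_one_of_dvd_coprimes x.reduced h1' h2
  omega


/-! ## The curve `234446a1` and four of its points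

`E4` denotes the Weierstrass curve `[a₁,a₂,a₃,a₄,a₆] = [1,−1,0,−79,289]` over `ℚ`, i.e.
`y² + xy = x³ − x² − 79x + 289` (Cremona label `234446a1`, discriminant `468892 = 2² · 117223`).  In
Lean it is the bound variable `W` under `hW : W = ⟨1, -1, 0, -79, 289⟩`. -/

variable {W : WeierstrassCurve ℚ}

/-- `a₁(E4) = 1`. -/
lemma E4_a₁ (hW : W = ⟨1, -1, 0, -79, 289⟩) : W.toAffine.a₁ = 1 := by subst hW; rfl
/-- `a₂(E4) = −1`. -/
lemma E4_a₂ (hW : W = ⟨1, -1, 0, -79, 289⟩) : W.toAffine.a₂ = -1 := by subst hW; rfl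
/-- `a₃(E4) = 0`. -/
lemma E4_a₃ (hW : W = ⟨1, -1, 0, -79, 289⟩) : W.toAffine.a₃ = 0 := by subst hW; rfl
/-- `a₄(E4) = −79`. -/
lemma E4_a₄ (hW : W = ⟨1, -1, 0, -79, 289⟩) : W.toAffine.a₄ = -79 := by subst hW; rfl
/-- `a₆(E4) = 289`. -/
lemma E4_a₆ (hW : W = ⟨1, -1, 0, -79, 289⟩) : W.toAffine.a₆ = 289 := by subst hW; rfl

/-- The discriminant of `E4` is `468892 ≠ 0`. -/
lemma E4_Δ (hW : W = ⟨1, -1, 0, -79, 289⟩) : W.Δ = 468892 := by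
  subst hW
  simp only [WeierstrassCurve.Δ, WeierstrassCurve.b₂, WeierstrassCurve.b₄, WeierstrassCurve.b₆,
    WeierstrassCurve.b₈]
  norm_num

/-- `E4` is an elliptic curve (`Δ ≠ 0`). -/
theorem E4_isElliptic (hW : W = ⟨1, -1, 0, -79, 289⟩) : W.IsElliptic :=
  ⟨by rw [E4_Δ hW]; exact isUnit_iff_ne_zero.mpr (by norm_num)⟩

/-- A pair `(x, y)` is a (automatically nonsingular) point of `E4` iff it satisfies the equation. -/
lemma E4_nonsingular_iff (hW : W = ⟨1, -1, 0, -79, 289⟩) {x y : ℚ} :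
    W.toAffine.Nonsingular x y ↔ y ^ 2 + x * y = x ^ 3 - x ^ 2 - 79 * x + 289 := by
  haveI := E4_isElliptic hW
  rw [← Affine.equation_iff_nonsingular, Affine.equation_iff]
  simp only [E4_a₁ hW, E4_a₂ hW, E4_a₃ hW, E4_a₄ hW, E4_a₆ hW]
  constructor <;> intro h <;> linear_combination h

/-- Affine points with equal coordinates are equal. -/
lemma some_eq_some {x y x' y' : ℚ} {h : W.toAffine.Nonsingular x y}
    {h' : W.toAffine.Nonsingular x' y'} (hx : x = x') (hy : y = y') :
    Point.some x y h = Point.some x' y' h' := by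
  subst hx hy; rfl

/-- `P₀ = (0, −17)` lies on `E4`. -/
theorem ns0 (hW : W = ⟨1, -1, 0, -79, 289⟩) : W.toAffine.Nonsingular 0 (-17) :=
  (E4_nonsingular_iff hW).mpr (by norm_num)
/-- `P₁ = (3, 7)` lies on `E4`. -/
theorem ns1 (hW : W = ⟨1, -1, 0, -79, 289⟩) : W.toAffine.Nonsingular 3 7 :=
  (E4_nonsingular_iff hW).mpr (by norm_num)
/-- `P₂ = (−4, −21)` lies on `E4`. -/
theorem ns2 (hW : W = ⟨1, -1, 0, -79, 289⟩) : W.toAffine.Nonsingular (-4) (-21) :=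
  (E4_nonsingular_iff hW).mpr (by norm_num)
/-- `P₃ = (4, 3)` lies on `E4`. -/
theorem ns3 (hW : W = ⟨1, -1, 0, -79, 289⟩) : W.toAffine.Nonsingular 4 3 :=
  (E4_nonsingular_iff hW).mpr (by norm_num)
/-- `P₀ + P₁ = (70, −613)` lies on `E4`. -/
theorem ns01 (hW : W = ⟨1, -1, 0, -79, 289⟩) : W.toAffine.Nonsingular 70 (-613) :=
  (E4_nonsingular_iff hW).mpr (by norm_num)
/-- `P₀ + P₂ = (7, 3)` lies on `E4`. -/
theorem ns02 (hW : W = ⟨1, -1, 0, -79, 289⟩) : W.toAffine.Nonsingular 7 3 :=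
  (E4_nonsingular_iff hW).mpr (by norm_num)
/-- `P₀ + P₃ = (27, −145)` lies on `E4`. -/
theorem ns03 (hW : W = ⟨1, -1, 0, -79, 289⟩) : W.toAffine.Nonsingular 27 (-145) :=
  (E4_nonsingular_iff hW).mpr (by norm_num)
/-- `P₁ + P₂ = (22, −105)` lies on `E4`. -/
theorem ns12 (hW : W = ⟨1, -1, 0, -79, 289⟩) : W.toAffine.Nonsingular 22 (-105) :=
  (E4_nonsingular_iff hW).mpr (by norm_num)
/-- `P₁ + P₃ = (6, −1)` lies on `E4`. -/
theorem ns13 (hW : W = ⟨1, -1, 0, -79, 289⟩) : W.toAffine.Nonsingular 6 (-1) :=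
  (E4_nonsingular_iff hW).mpr (by norm_num)
/-- `P₂ + P₃ = (13, −43)` lies on `E4`. -/
theorem ns23 (hW : W = ⟨1, -1, 0, -79, 289⟩) : W.toAffine.Nonsingular 13 (-43) :=
  (E4_nonsingular_iff hW).mpr (by norm_num)
/-- `P₀ + P₁ + P₂ = (−9, −10)` lies on `E4`. -/
theorem ns012 (hW : W = ⟨1, -1, 0, -79, 289⟩) : W.toAffine.Nonsingular (-9) (-10) :=
  (E4_nonsingular_iff hW).mpr (by norm_num)
/-- `P₀ + P₁ + P₃ = (43/9, −14/27)` lies on `E4`. -/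
theorem ns013 (hW : W = ⟨1, -1, 0, -79, 289⟩) : W.toAffine.Nonsingular (43/9) (-14/27) :=
  (E4_nonsingular_iff hW).mpr (by norm_num)
/-- `P₀ + P₂ + P₃ = (−10, 7)` lies on `E4`. -/
theorem ns023 (hW : W = ⟨1, -1, 0, -79, 289⟩) : W.toAffine.Nonsingular (-10) 7 :=
  (E4_nonsingular_iff hW).mpr (by norm_num)
/-- `P₁ + P₂ + P₃ = (5, −2)` lies on `E4`. -/
theorem ns123 (hW : W = ⟨1, -1, 0, -79, 289⟩) : W.toAffine.Nonsingular 5 (-2) :=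
  (E4_nonsingular_iff hW).mpr (by norm_num)
/-- `P₀ + P₁ + P₂ + P₃ = (8, −15)` lies on `E4`. -/
theorem ns0123 (hW : W = ⟨1, -1, 0, -79, 289⟩) : W.toAffine.Nonsingular 8 (-15) :=
  (E4_nonsingular_iff hW).mpr (by norm_num)

section MordellWeilGroup

/-! All statements about the group law are made for an ARBITRARY `DecidableEq ℚ` instance (the
group structure `Point.instAddCommGroup` depends on one), so that they specialise both to the
computable instance and to the classical one used by `WeierstrassCurve.mordellWeilRank`. -/

variable [DecidableEq ℚ]

/-- Chord addition on `E4` with the coordinates spelled out (`a₁ = 1`, `a₂ = −1`, `a₃ = 0`). -/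
lemma some_add_some (hW : W = ⟨1, -1, 0, -79, 289⟩) {x₁ y₁ x₂ y₂ x₃ y₃ : ℚ}
    (h₁ : W.toAffine.Nonsingular x₁ y₁) (h₂ : W.toAffine.Nonsingular x₂ y₂)
    (h₃ : W.toAffine.Nonsingular x₃ y₃) (hx : x₁ ≠ x₂)
    (ex : ((y₁ - y₂) / (x₁ - x₂)) ^ 2 + (y₁ - y₂) / (x₁ - x₂) + 1 - x₁ - x₂ = x₃)
    (ey : -((y₁ - y₂) / (x₁ - x₂) * (x₃ - x₁) + y₁) - x₃ = y₃) :
    Point.some x₁ y₁ h₁ + Point.some x₂ y₂ h₂ = Point.some x₃ y₃ h₃ := by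
  rw [Point.add_of_X_ne hx]
  refine some_eq_some ?_ ?_
  · simp only [addX, slope_of_X_ne hx, E4_a₁ hW, E4_a₂ hW]
    linear_combination ex
  · simp only [addY, negAddY, addX, negY, slope_of_X_ne hx, E4_a₁ hW, E4_a₂ hW, E4_a₃ hW]
    linear_combination ey + (-((y₁ - y₂) / (x₁ - x₂)) - 1) * ex

/-- `P0 + P1 = P01` (chord formula). -/
lemma P0_add_P1 (hW : W = ⟨1, -1, 0, -79, 289⟩) :
    Point.some _ _ (ns0 hW) + Point.some _ _ (ns1 hW) = Point.some _ _ (ns01 hW) :=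
  some_add_some hW _ _ _ (by norm_num) (by norm_num) (by norm_num)
/-- `P0 + P2 = P02` (chord formula). -/
lemma P0_add_P2 (hW : W = ⟨1, -1, 0, -79, 289⟩) :
    Point.some _ _ (ns0 hW) + Point.some _ _ (ns2 hW) = Point.some _ _ (ns02 hW) :=
  some_add_some hW _ _ _ (by norm_num) (by norm_num) (by norm_num)
/-- `P0 + P3 = P03` (chord formula). -/
lemma P0_add_P3 (hW : W = ⟨1, -1, 0, -79, 289⟩) :
    Point.some _ _ (ns0 hW) + Point.some _ _ (ns3 hW) = Point.some _ _ (ns03 hW) :=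
  some_add_some hW _ _ _ (by norm_num) (by norm_num) (by norm_num)
/-- `P1 + P2 = P12` (chord formula). -/
lemma P1_add_P2 (hW : W = ⟨1, -1, 0, -79, 289⟩) :
    Point.some _ _ (ns1 hW) + Point.some _ _ (ns2 hW) = Point.some _ _ (ns12 hW) :=
  some_add_some hW _ _ _ (by norm_num) (by norm_num) (by norm_num)
/-- `P1 + P3 = P13` (chord formula). -/
lemma P1_add_P3 (hW : W = ⟨1, -1, 0, -79, 289⟩) :
    Point.some _ _ (ns1 hW) + Point.some _ _ (ns3 hW) = Point.some _ _ (ns13 hW) :=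
  some_add_some hW _ _ _ (by norm_num) (by norm_num) (by norm_num)
/-- `P2 + P3 = P23` (chord formula). -/
lemma P2_add_P3 (hW : W = ⟨1, -1, 0, -79, 289⟩) :
    Point.some _ _ (ns2 hW) + Point.some _ _ (ns3 hW) = Point.some _ _ (ns23 hW) :=
  some_add_some hW _ _ _ (by norm_num) (by norm_num) (by norm_num)
/-- `P01 + P2 = P012` (chord formula). -/
lemma P01_add_P2 (hW : W = ⟨1, -1, 0, -79, 289⟩) :
    Point.some _ _ (ns01 hW) + Point.some _ _ (ns2 hW) = Point.some _ _ (ns012 hW) :=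
  some_add_some hW _ _ _ (by norm_num) (by norm_num) (by norm_num)
/-- `P01 + P3 = P013` (chord formula). -/
lemma P01_add_P3 (hW : W = ⟨1, -1, 0, -79, 289⟩) :
    Point.some _ _ (ns01 hW) + Point.some _ _ (ns3 hW) = Point.some _ _ (ns013 hW) :=
  some_add_some hW _ _ _ (by norm_num) (by norm_num) (by norm_num)
/-- `P02 + P3 = P023` (chord formula). -/
lemma P02_add_P3 (hW : W = ⟨1, -1, 0, -79, 289⟩) :
    Point.some _ _ (ns02 hW) + Point.some _ _ (ns3 hW) = Point.some _ _ (ns023 hW) :=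
  some_add_some hW _ _ _ (by norm_num) (by norm_num) (by norm_num)
/-- `P12 + P3 = P123` (chord formula). -/
lemma P12_add_P3 (hW : W = ⟨1, -1, 0, -79, 289⟩) :
    Point.some _ _ (ns12 hW) + Point.some _ _ (ns3 hW) = Point.some _ _ (ns123 hW) :=
  some_add_some hW _ _ _ (by norm_num) (by norm_num) (by norm_num)
/-- `P012 + P3 = P0123` (chord formula). -/
lemma P012_add_P3 (hW : W = ⟨1, -1, 0, -79, 289⟩) :
    Point.some _ _ (ns012 hW) + Point.some _ _ (ns3 hW) = Point.some _ _ (ns0123 hW) :=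
  some_add_some hW _ _ _ (by norm_num) (by norm_num) (by norm_num)

/-! ## Doubles and two-torsion -/

/-- If `Q = (x_Q, y_Q) ∈ E4(ℚ)` equals `R + R` for some `R ∈ E4(ℚ)`, then `x(R)` is a rational zero
of `φ₂(x) − x_Q ψ₂²(x)`; so if that quartic has no rational zero, `Q` is not a double. -/
theorem not_double (hW : W = ⟨1, -1, 0, -79, 289⟩) {xq yq : ℚ} (hq : W.toAffine.Nonsingular xq yq)
    (hroot : ∀ x : ℚ, x ^ 4 + 158 * x ^ 2 - 2312 * x + 7108
      - xq * (4 * x ^ 3 - 3 * x ^ 2 - 316 * x + 1156) ≠ 0)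
    (R : W.toAffine.Point) : Point.some xq yq hq ≠ R + R := by
  rcases R with _ | ⟨x, y, h⟩
  · intro e
    exact Point.some_ne_zero _ e
  · by_cases hy : y = W.toAffine.negY x y
    · rw [Point.add_self_of_Y_eq hy]
      exact Point.some_ne_zero _
    · rw [Point.add_self_of_Y_ne hy]
      intro e
      obtain ⟨ex, -⟩ := Point.some.inj e
      have h' : y ^ 2 + x * y = x ^ 3 - x ^ 2 - 79 * x + 289 := (E4_nonsingular_iff hW).mp h
      have hden : y - W.toAffine.negY x y = 2 * y + x := by
        simp only [negY, E4_a₁ hW, E4_a₃ hW]; ring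
      have hd : 2 * y + x ≠ 0 := by
        intro h0; apply hy; simp only [negY, E4_a₁ hW, E4_a₃ hW]; linarith
      have hnum : 3 * x ^ 2 + 2 * W.toAffine.a₂ * x + W.toAffine.a₄ - W.toAffine.a₁ * y
          = 3 * x ^ 2 - 2 * x - 79 - y := by
        rw [E4_a₁ hW, E4_a₂ hW, E4_a₄ hW]; ring
      rw [slope_of_Y_ne rfl hy, hden, hnum] at ex
      simp only [addX, E4_a₁ hW, E4_a₂ hW] at ex
      have ex2 : xq * (2 * y + x) ^ 2 = (3 * x ^ 2 - 2 * x - 79 - y) ^ 2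
          + (3 * x ^ 2 - 2 * x - 79 - y) * (2 * y + x) + (1 - 2 * x) * (2 * y + x) ^ 2 := by
        rw [ex]; field_simp; ring
      exact hroot x (by linear_combination (-1 : ℚ) * ex2 + (8 * x - 3 + 4 * xq) * h')

/-- `E4(ℚ)` has no point of order two: the 2-division cubic has no zero in `ℙ¹(𝔽₃)`. -/
theorem E4_two_torsion_free (hW : W = ⟨1, -1, 0, -79, 289⟩) (R : W.toAffine.Point)
    (hR : R + R = 0) : R = 0 := by
  rcases R with _ | ⟨x, y, h⟩
  · rfl
  · exfalso
    by_cases hy : y = W.toAffine.negY x y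
    · have h' := (E4_nonsingular_iff hW).mp h
      have hy2 : 2 * y + x = 0 := by
        simp only [negY, E4_a₁ hW, E4_a₃ hW] at hy; linarith
      have hψ : (4 : ℚ) * x ^ 3 + (-3) * x ^ 2 + (-316) * x + 1156 = 0 := by
        linear_combination (2 * y + x) * hy2 - 4 * h'
      exact cubic_ne_zero_of_zmod 3 (by norm_num) 1156 (-316) (-3) 4 (by decide) x
        (by push_cast; linear_combination hψ)
    · rw [Point.add_self_of_Y_ne hy] at hR
      exact Point.some_ne_zero _ hR

end MordellWeilGroup

end Summit.BirchSwinnertonDyer.BirchSwinnertonDyer.Theorems.SoloBlind
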